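import Mathlib
import HarnessLib
import Summits.NavierStokesRegularity.NavierStokesRegularity.Theorems.PoloidalWindowDoorLrcModEntireTwistingTHFlatRidgeArcDefinite
import Summits.NavierStokesRegularity.NavierStokesRegularity.Theorems.PoloidalWindowDoorLrcModEntireTwistingTHFlatRidgeArcTimePin

/-!
# Item `LrcModEntire` (stmt-NavierStokesRegularity-20428) — THE FLAT SUB-CELL ALONG A HOT ARC: where the time–time pin is SATURATED the transversal quartic vanishes

ns-k2-port-2 g7, helper of item 20428 (LEAD lineage ns-poloidal-K2-p3; `--supports stmt-NavierStokesRegularity-20428 --as helper`).  Memo `Cruxes/LrcModEntire/T2B-g15.md` §16b/§17d.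
At every hot point `σθ_tt ≤ 3|N|/4` (`…FlatRidgeMixedPin.timeTimePin_of_hotPoint`).  Along a differentiable unit-speed hot arc `γ ⊂ P₀` the arc time pin
(`…FlatRidgeArcTimePin.arcQuarticTimePin_of_flatHotArc`) reads `3(−σP(s)) ≤ 3|N|/4 − σθ_tt(γ s)` for the transversal quartic coefficient `P(s) = ∂_ν⁴θ(γ s)`, `ν = Jγ′(s)`,
and `B₃(s)² ≤ −μ₀P(s)²` (`…FlatRidgeArcDefinite.oddQuartic_sq_le_of_form` with the arc package).  Hence:

* ★ `transversalQuartic_eq_zero_of_timeSaturated` — at an arc point where the time–time pin is SATURATED, `σθ_tt(γ s) = 3|N|/4`: **`P(s) = 0`, `B₃(s) = 0`, the whole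
  transversal binary quartic `F_s(n,z) = D⁴θ(γ s)[(nν + ze₂)⁴]` vanishes identically, and the LEAD g15 lever is NOT definite there** (so `u = N − σθ` vanishes to order ≥ 5
  transversally at such a point; by `…FlatSeparation` such a point cannot lie strictly between two definite arc points);
* `timePin_strict_of_transversalQuartic_ne_zero` — contrapositive: where `P(s) ≠ 0` the time–time pin is STRICT, `σθ_tt(γ s) ≤ 3|N|/4 − 3(−σP(s)) < 3|N|/4`.

WHAT THIS IS NOT: not a claim about Navier–Stokes regularity and not a proof of `stub_T2bFlat` (bears_on LADDER-NS N0, item 20428 / crux 19708; OPEN).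
-/

set_option linter.style.longLine false
set_option linter.dupNamespace false

namespace Summit.NavierStokesRegularity.NavierStokesRegularity.Theorems.PoloidalWindowDoorLrcModEntireTwistingTHFlatRidgeArcSaturated

open Set Function Filter Topology Metric
open scoped RealInnerProductSpace InnerProductSpace ContDiff
open Literature.Analysis Literature.Analysis.FluidPDE Literature.Analysis.UnboundedOperators
open Summit.NavierStokesRegularity.NavierStokesRegularity.Theorems
open Summit.NavierStokesRegularity.NavierStokesRegularity.Theorems.LocalSineTubeDoorProfileAlignedWindowRigidityAncient
open Summit.NavierStokesRegularity.NavierStokesRegularity.Theorems.PoloidalWindowDoorLrcModEntireTwistingTHFlatRidgeQuarticDefinite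
open Summit.NavierStokesRegularity.NavierStokesRegularity.Theorems.PoloidalWindowDoorLrcModEntireTwistingTHFlatRidgeArcForm
open Summit.NavierStokesRegularity.NavierStokesRegularity.Theorems.PoloidalWindowDoorLrcModEntireTwistingTHFlatRidgeArcDefinite
open Summit.NavierStokesRegularity.NavierStokesRegularity.Theorems.PoloidalWindowDoorLrcModEntireTwistingTHFlatRidgeArcTimePin

variable {C : ℝ} {v : ℝ → EuclideanSpace ℝ (Fin 3) → EuclideanSpace ℝ (Fin 3)}

/-- ★ **SATURATED TIME–TIME PIN ⇒ THE TRANSVERSAL QUARTIC VANISHES.**  Flat-cell binders VERBATIM, a differentiable unit-speed hot arc `γ ⊂ P₀`, an arc point `s` with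
`σ∂ₜ²v₂(·, γ s)(−1) = 3|v₂(−1,0)|/4`; with `T = deriv γ s`, `ν = JT`, `y = γ s`: `P = 0`, `B₃ = 0`, `F_s ≡ 0`, and no `λ > 0` with `λ(n⁴+z⁴) ≤ −σF_s(n,z)`. -/
theorem transversalQuartic_eq_zero_of_timeSaturated (hdec : HasTypeITimeDecay C v) (hcont : ContinuousOn (uncurry v) (Iio (0 : ℝ) ×ˢ univ))
    (hmild : ∀ s t : ℝ, s < t → t < 0 → ∀ x, v t x = heatExtension (v s) (t - s) x - oseenDuhamel 1 s v v t x)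
    (hdiv : ∀ t < 0, VectorCalculus.IsDivFree (v t))
    (hpol : ∀ s < 0, ∀ y, ⟪curl (v s) y, EuclideanSpace.single 2 1⟫_ℝ = 0)
    (hTH : ∀ t < 0, ∀ x x' : EuclideanSpace ℝ (Fin 3), x 2 = x' 2 → ∀ b c : Fin 3, b ≠ 2 → c ≠ 2 →
      fderiv ℝ (v t) x (EuclideanSpace.single 2 1) b * fderiv ℝ (v t) x' (EuclideanSpace.single c 1) 2 =
        fderiv ℝ (v t) x' (EuclideanSpace.single 2 1) c * fderiv ℝ (v t) x (EuclideanSpace.single b 1) 2)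
    (hne : v (-1) 0 2 ≠ 0) (hhot : ∀ t < 0, ∀ x, Real.sqrt (-t) * |v t x 2| ≤ |v (-1) 0 2|)
    (hproper : ∀ y ∈ {y : EuclideanSpace ℝ (Fin 3) | y 2 = 0 ∧ v (-1) y 2 = v (-1) 0 2}, ∀ r : ℝ, 0 < r →
      ∃ y' : EuclideanSpace ℝ (Fin 3), y' 2 = 0 ∧ dist y' y < r ∧ v (-1) y' 2 ≠ v (-1) 0 2)
    {σ : ℝ} (hσ : σ = 1 ∨ σ = -1) (hσN : σ * v (-1) 0 2 = |v (-1) 0 2|)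
    (hflatAll : ∀ y : EuclideanSpace ℝ (Fin 3), y 2 = 0 → v (-1) y 2 = v (-1) 0 2 →
      fderiv ℝ (fderiv ℝ (fun x => σ * v (-1) x 2)) y (EuclideanSpace.single 0 1) (EuclideanSpace.single 0 1) +
        fderiv ℝ (fderiv ℝ (fun x => σ * v (-1) x 2)) y (EuclideanSpace.single 1 1) (EuclideanSpace.single 1 1) = 0)
    {γ : ℝ → EuclideanSpace ℝ (Fin 3)} (hγd : Differentiable ℝ γ) (hγ2 : ∀ s, γ s 2 = 0) (hγv : ∀ s, v (-1) (γ s) 2 = v (-1) 0 2)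
    (hunit : ∀ s, ‖deriv γ s‖ = 1) (s : ℝ) (T : EuclideanSpace ℝ (Fin 3)) (hT : T = deriv γ s) (y : EuclideanSpace ℝ (Fin 3)) (hyγ : y = γ s)
    (hsat : σ * deriv (deriv (fun s' => v s' y 2)) (-1) = 3 * |v (-1) 0 2| / 4) :
    fderiv ℝ (fderiv ℝ (fun x => fderiv ℝ (fderiv ℝ (fun x' => (v (-1) x' 2 : ℝ))) x ((-T 1) • EuclideanSpace.single 0 (1 : ℝ) + T 0 • EuclideanSpace.single 1 (1 : ℝ)) ((-T 1) • EuclideanSpace.single 0 (1 : ℝ) + T 0 • EuclideanSpace.single 1 (1 : ℝ)))) y ((-T 1) • EuclideanSpace.single 0 (1 : ℝ) + T 0 • EuclideanSpace.single 1 (1 : ℝ)) ((-T 1) • EuclideanSpace.single 0 (1 : ℝ) + T 0 • EuclideanSpace.single 1 (1 : ℝ)) = 0 ∧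
      fderiv ℝ (fderiv ℝ (fun x => fderiv ℝ (fderiv ℝ (fun x' => (v (-1) x' 2 : ℝ))) x ((-T 1) • EuclideanSpace.single 0 (1 : ℝ) + T 0 • EuclideanSpace.single 1 (1 : ℝ)) ((-T 1) • EuclideanSpace.single 0 (1 : ℝ) + T 0 • EuclideanSpace.single 1 (1 : ℝ)))) y ((-T 1) • EuclideanSpace.single 0 (1 : ℝ) + T 0 • EuclideanSpace.single 1 (1 : ℝ)) (EuclideanSpace.single 2 (1 : ℝ)) = 0 ∧
      (∀ n z : ℝ, fderiv ℝ (fderiv ℝ (fun x => fderiv ℝ (fderiv ℝ (fun x' => (v (-1) x' 2 : ℝ))) x (n • ((-T 1) • EuclideanSpace.single 0 (1 : ℝ) + T 0 • EuclideanSpace.single 1 (1 : ℝ)) + z • (EuclideanSpace.single 2 (1 : ℝ))) (n • ((-T 1) • EuclideanSpace.single 0 (1 : ℝ) + T 0 • EuclideanSpace.single 1 (1 : ℝ)) + z • (EuclideanSpace.single 2 (1 : ℝ))))) y (n • ((-T 1) • EuclideanSpace.single 0 (1 : ℝ) + T 0 • EuclideanSpace.single 1 (1 : ℝ)) + z • (EuclideanSpace.single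 2 (1 : ℝ))) (n • ((-T 1) • EuclideanSpace.single 0 (1 : ℝ) + T 0 • EuclideanSpace.single 1 (1 : ℝ)) + z • (EuclideanSpace.single 2 (1 : ℝ))) = 0) ∧
      ¬ (∃ lam : ℝ, 0 < lam ∧ ∀ n z : ℝ, lam * (n ^ 4 + z ^ 4) ≤ -(σ * fderiv ℝ (fderiv ℝ (fun x => fderiv ℝ (fderiv ℝ (fun x' => (v (-1) x' 2 : ℝ))) x (n • ((-T 1) • EuclideanSpace.single 0 (1 : ℝ) + T 0 • EuclideanSpace.single 1 (1 : ℝ)) + z • (EuclideanSpace.single 2 (1 : ℝ))) (n • ((-T 1) • EuclideanSpace.single 0 (1 : ℝ) + T 0 • EuclideanSpace.single 1 (1 : ℝ)) + z • (EuclideanSpace.single 2 (1 : ℝ))))) y (n • ((-T 1) • EuclideanSpace.single 0 (1 : ℝ) + T 0 • EuclideanSpace.single 1 (1 : ℝ)) + z • (EuclideanSpace.single 2 (1 : ℝ))) (n • ((-T 1) • EuclideanSpace.single 0 (1 : ℝ) + T 0 • EuclideanSpace.single 1 (1 : ℝ)) + z • (EuclideanSpace.single 2 (1 : ℝ)))))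 := by
  -- the arc time pin: `3(−σP) ≤ 3|N|/4 − σθ_tt = 0`
  obtain ⟨-, hpin⟩ := arcQuarticTimePin_of_flatHotArc hdec hcont hmild hdiv hpol hTH hne hhot hproper hσN hflatAll hγd hγ2 hγv hunit s T hT y hyγ
  rw [hsat, sub_self] at hpin
  -- the arc package at `s`: signed expansion with one slope `μ₀`
  obtain ⟨μ₀, hμ0, harc⟩ := arcQuarticForm_of_flatHotArc hdec hcont hmild hdiv hpol hTH hne hhot hproper hσN hflatAll hγd hγ2 hγv hunit
  obtain ⟨-, hE⟩ := harc s T hT y hyγ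
  have hform := fun n z : ℝ => by
    have h := (hE n z).2
    rw [(hE n z).1] at h
    exact h
  -- `σP ≤ 0` (sign at `(1,0)`) and `−σP ≤ 0` (pin) ⇒ `P = 0`
  have hσP : σ * fderiv ℝ (fderiv ℝ (fun x => fderiv ℝ (fderiv ℝ (fun x' => (v (-1) x' 2 : ℝ))) x ((-T 1) • EuclideanSpace.single 0 (1 : ℝ) + T 0 • EuclideanSpace.single 1 (1 : ℝ)) ((-T 1) • EuclideanSpace.single 0 (1 : ℝ) + T 0 • EuclideanSpace.single 1 (1 : ℝ)))) y ((-T 1) • EuclideanSpace.single 0 (1 : ℝ) + T 0 • EuclideanSpace.single 1 (1 : ℝ)) ((-T 1) • EuclideanSpace.single 0 (1 : ℝ) + T 0 • EuclideanSpace.single 1 (1 : ℝ)) ≤ 0 := by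
    simpa using hform 1 0
  have hσ0 : σ ≠ 0 := by rcases hσ with rfl | rfl <;> norm_num
  have hP : fderiv ℝ (fderiv ℝ (fun x => fderiv ℝ (fderiv ℝ (fun x' => (v (-1) x' 2 : ℝ))) x ((-T 1) • EuclideanSpace.single 0 (1 : ℝ) + T 0 • EuclideanSpace.single 1 (1 : ℝ)) ((-T 1) • EuclideanSpace.single 0 (1 : ℝ) + T 0 • EuclideanSpace.single 1 (1 : ℝ)))) y ((-T 1) • EuclideanSpace.single 0 (1 : ℝ) + T 0 • EuclideanSpace.single 1 (1 : ℝ)) ((-T 1) • EuclideanSpace.single 0 (1 : ℝ) + T 0 • EuclideanSpace.single 1 (1 : ℝ)) = 0 := by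
    have h0 : σ * fderiv ℝ (fderiv ℝ (fun x => fderiv ℝ (fderiv ℝ (fun x' => (v (-1) x' 2 : ℝ))) x ((-T 1) • EuclideanSpace.single 0 (1 : ℝ) + T 0 • EuclideanSpace.single 1 (1 : ℝ)) ((-T 1) • EuclideanSpace.single 0 (1 : ℝ) + T 0 • EuclideanSpace.single 1 (1 : ℝ)))) y ((-T 1) • EuclideanSpace.single 0 (1 : ℝ) + T 0 • EuclideanSpace.single 1 (1 : ℝ)) ((-T 1) • EuclideanSpace.single 0 (1 : ℝ) + T 0 • EuclideanSpace.single 1 (1 : ℝ)) = 0 := by linarith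
    exact (mul_eq_zero.1 h0).resolve_left hσ0
  -- `B₃² ≤ −μ₀P² = 0`
  have hB : fderiv ℝ (fderiv ℝ (fun x => fderiv ℝ (fderiv ℝ (fun x' => (v (-1) x' 2 : ℝ))) x ((-T 1) • EuclideanSpace.single 0 (1 : ℝ) + T 0 • EuclideanSpace.single 1 (1 : ℝ)) ((-T 1) • EuclideanSpace.single 0 (1 : ℝ) + T 0 • EuclideanSpace.single 1 (1 : ℝ)))) y ((-T 1) • EuclideanSpace.single 0 (1 : ℝ) + T 0 • EuclideanSpace.single 1 (1 : ℝ)) (EuclideanSpace.single 2 (1 : ℝ)) = 0 := by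
    have h := oddQuartic_sq_le_of_form hσ hμ0 hform
    rw [hP] at h
    have h' : fderiv ℝ (fderiv ℝ (fun x => fderiv ℝ (fderiv ℝ (fun x' => (v (-1) x' 2 : ℝ))) x ((-T 1) • EuclideanSpace.single 0 (1 : ℝ) + T 0 • EuclideanSpace.single 1 (1 : ℝ)) ((-T 1) • EuclideanSpace.single 0 (1 : ℝ) + T 0 • EuclideanSpace.single 1 (1 : ℝ)))) y ((-T 1) • EuclideanSpace.single 0 (1 : ℝ) + T 0 • EuclideanSpace.single 1 (1 : ℝ)) (EuclideanSpace.single 2 (1 : ℝ)) ^ 2 ≤ 0 := by simpa using h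
    exact pow_eq_zero_iff (n := 2) (by norm_num) |>.1 (le_antisymm h' (sq_nonneg _))
  have hF : ∀ n z : ℝ, fderiv ℝ (fderiv ℝ (fun x => fderiv ℝ (fderiv ℝ (fun x' => (v (-1) x' 2 : ℝ))) x (n • ((-T 1) • EuclideanSpace.single 0 (1 : ℝ) + T 0 • EuclideanSpace.single 1 (1 : ℝ)) + z • (EuclideanSpace.single 2 (1 : ℝ))) (n • ((-T 1) • EuclideanSpace.single 0 (1 : ℝ) + T 0 • EuclideanSpace.single 1 (1 : ℝ)) + z • (EuclideanSpace.single 2 (1 : ℝ))))) y (n • ((-T 1) • EuclideanSpace.single 0 (1 : ℝ) + T 0 • EuclideanSpace.single 1 (1 : ℝ)) + z • (EuclideanSpace.single 2 (1 : ℝ))) (n • ((-T 1) • EuclideanSpace.single 0 (1 : ℝ) + T 0 • EuclideanSpace.single 1 (1 : ℝ)) + z • (EuclideanSpace.single 2 (1 : ℝ))) = 0 := fun n z => by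
    rw [(hE n z).1, hP, hB]
    ring
  refine ⟨hP, hB, hF, ?_⟩
  rintro ⟨lam, hlam, hdef⟩
  have h := hdef 1 0
  rw [hF 1 0] at h
  norm_num at h
  linarith

/-- **Where the transversal quartic coefficient is non-zero, the time–time pin is STRICT**: `P(s) ≠ 0 ⇒ σθ_tt(γ s) ≤ 3|N|/4 − 3(−σP(s)) < 3|N|/4`. -/
theorem timePin_strict_of_transversalQuartic_ne_zero (hdec : HasTypeITimeDecay C v) (hcont : ContinuousOn (uncurry v) (Iio (0 : ℝ) ×ˢ univ))
    (hmild : ∀ s t : ℝ, s < t → t < 0 → ∀ x, v t x = heatExtension (v s) (t - s) x - oseenDuhamel 1 s v v t x)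
    (hdiv : ∀ t < 0, VectorCalculus.IsDivFree (v t))
    (hpol : ∀ s < 0, ∀ y, ⟪curl (v s) y, EuclideanSpace.single 2 1⟫_ℝ = 0)
    (hTH : ∀ t < 0, ∀ x x' : EuclideanSpace ℝ (Fin 3), x 2 = x' 2 → ∀ b c : Fin 3, b ≠ 2 → c ≠ 2 →
      fderiv ℝ (v t) x (EuclideanSpace.single 2 1) b * fderiv ℝ (v t) x' (EuclideanSpace.single c 1) 2 =
        fderiv ℝ (v t) x' (EuclideanSpace.single 2 1) c * fderiv ℝ (v t) x (EuclideanSpace.single b 1) 2)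
    (hne : v (-1) 0 2 ≠ 0) (hhot : ∀ t < 0, ∀ x, Real.sqrt (-t) * |v t x 2| ≤ |v (-1) 0 2|)
    (hproper : ∀ y ∈ {y : EuclideanSpace ℝ (Fin 3) | y 2 = 0 ∧ v (-1) y 2 = v (-1) 0 2}, ∀ r : ℝ, 0 < r →
      ∃ y' : EuclideanSpace ℝ (Fin 3), y' 2 = 0 ∧ dist y' y < r ∧ v (-1) y' 2 ≠ v (-1) 0 2)
    {σ : ℝ} (hσ : σ = 1 ∨ σ = -1) (hσN : σ * v (-1) 0 2 = |v (-1) 0 2|)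
    (hflatAll : ∀ y : EuclideanSpace ℝ (Fin 3), y 2 = 0 → v (-1) y 2 = v (-1) 0 2 →
      fderiv ℝ (fderiv ℝ (fun x => σ * v (-1) x 2)) y (EuclideanSpace.single 0 1) (EuclideanSpace.single 0 1) +
        fderiv ℝ (fderiv ℝ (fun x => σ * v (-1) x 2)) y (EuclideanSpace.single 1 1) (EuclideanSpace.single 1 1) = 0)
    {γ : ℝ → EuclideanSpace ℝ (Fin 3)} (hγd : Differentiable ℝ γ) (hγ2 : ∀ s, γ s 2 = 0) (hγv : ∀ s, v (-1) (γ s) 2 = v (-1) 0 2)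
    (hunit : ∀ s, ‖deriv γ s‖ = 1) (s : ℝ) (T : EuclideanSpace ℝ (Fin 3)) (hT : T = deriv γ s) (y : EuclideanSpace ℝ (Fin 3)) (hyγ : y = γ s)
    (hP : fderiv ℝ (fderiv ℝ (fun x => fderiv ℝ (fderiv ℝ (fun x' => (v (-1) x' 2 : ℝ))) x ((-T 1) • EuclideanSpace.single 0 (1 : ℝ) + T 0 • EuclideanSpace.single 1 (1 : ℝ)) ((-T 1) • EuclideanSpace.single 0 (1 : ℝ) + T 0 • EuclideanSpace.single 1 (1 : ℝ)))) y ((-T 1) • EuclideanSpace.single 0 (1 : ℝ) + T 0 • EuclideanSpace.single 1 (1 : ℝ)) ((-T 1) • EuclideanSpace.single 0 (1 : ℝ) + T 0 • EuclideanSpace.single 1 (1 : ℝ)) ≠ 0) :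
    σ * deriv (deriv (fun s' => v s' y 2)) (-1) < 3 * |v (-1) 0 2| / 4 := by
  obtain ⟨-, hpin⟩ := arcQuarticTimePin_of_flatHotArc hdec hcont hmild hdiv hpol hTH hne hhot hproper hσN hflatAll hγd hγ2 hγv hunit s T hT y hyγ
  obtain ⟨μ₀, hμ0, harc⟩ := arcQuarticForm_of_flatHotArc hdec hcont hmild hdiv hpol hTH hne hhot hproper hσN hflatAll hγd hγ2 hγv hunit
  obtain ⟨-, hE⟩ := harc s T hT y hyγ
  have hform := fun n z : ℝ => by
    have h := (hE n z).2
    rw [(hE n z).1] at h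
    exact h
  have hσP : σ * fderiv ℝ (fderiv ℝ (fun x => fderiv ℝ (fderiv ℝ (fun x' => (v (-1) x' 2 : ℝ))) x ((-T 1) • EuclideanSpace.single 0 (1 : ℝ) + T 0 • EuclideanSpace.single 1 (1 : ℝ)) ((-T 1) • EuclideanSpace.single 0 (1 : ℝ) + T 0 • EuclideanSpace.single 1 (1 : ℝ)))) y ((-T 1) • EuclideanSpace.single 0 (1 : ℝ) + T 0 • EuclideanSpace.single 1 (1 : ℝ)) ((-T 1) • EuclideanSpace.single 0 (1 : ℝ) + T 0 • EuclideanSpace.single 1 (1 : ℝ)) ≤ 0 := by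
    simpa using hform 1 0
  have hσ0 : σ ≠ 0 := by rcases hσ with rfl | rfl <;> norm_num
  have hlt : σ * fderiv ℝ (fderiv ℝ (fun x => fderiv ℝ (fderiv ℝ (fun x' => (v (-1) x' 2 : ℝ))) x ((-T 1) • EuclideanSpace.single 0 (1 : ℝ) + T 0 • EuclideanSpace.single 1 (1 : ℝ)) ((-T 1) • EuclideanSpace.single 0 (1 : ℝ) + T 0 • EuclideanSpace.single 1 (1 : ℝ)))) y ((-T 1) • EuclideanSpace.single 0 (1 : ℝ) + T 0 • EuclideanSpace.single 1 (1 : ℝ)) ((-T 1) • EuclideanSpace.single 0 (1 : ℝ) + T 0 • EuclideanSpace.single 1 (1 : ℝ)) < 0 := by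
    rcases lt_or_eq_of_le hσP with h | h
    · exact h
    · exact absurd ((mul_eq_zero.1 h).resolve_left hσ0) hP
  linarith

end Summit.NavierStokesRegularity.NavierStokesRegularity.Theorems.PoloidalWindowDoorLrcModEntireTwistingTHFlatRidgeArcSaturated
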